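import Summits.BirchSwinnertonDyer.BirchSwinnertonDyer.Theses.KatoDescentTamePotSupersingular
import Summits.BirchSwinnertonDyer.BirchSwinnertonDyer.Theorems.KatoDescentPotSupersingularReducibleKatoMemberOfFineInputsPotSupersingular
import Literature.NumberTheory.EllipticCurves.NonEisensteinPrimeOfSurjective
import HarnessLib

/-!
# Route `KatoDescentTamePotSupersingular` (K8-t′): U₀-red `TameUpperReducibleDefect` BY NAME, and the rank-`0` assembly's row text
# with crux M REPLACED, from {modularity, `exists_memberHullZetaFineInputs`, H2X⁺, Lim 3.5, Ferrero–Washington} (+ Cassels / GZK /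
# entire `L`) — NO Imai, NO 27962 (`--supports` crux M = stmt-BirchSwinnertonDyer-19196; seat `bsd-potss-rkm` g31; closes nothing)

Every K8-t′ row is a TAME row `Addv W p ∧ SubTprime W p` (odd `p`, census cell (t′) ⊆ `ClassO5`), hence potentially
SUPERSINGULAR at `p`, and there Imai's finiteness at Kato's member (hypothesis `hfin` of H2X⁺) is a TREE THEOREM
(`TowerTorsionFinite…`, p680430: Serre 1967 §5 Prop. 8 proved by cell `bsd-wall`).  The route-free sibling
`…ReducibleKatoMemberOfFineInputsPotSupersingular` (p680784) runs crux M's chain per row with that theorem in place of Imai.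
Consequences BY NAME on this route (the K9 twins are in `…KatoDescentPotSupersingularU0RedOfFineInputsPotSupersingular`):

* `tameUpperReducibleDefect_of_fineInputs` — item 19203 `TameUpperReducibleDefect` (U₀-red) from {`exists_isNewformOf`,
  `exists_memberHullZetaFineInputs`, `exists_iwasawaH2Data_fineSelmerDual_embedding_count`, Lim 3.5, Ferrero–Washington,
  `bsdRHS_eq_of_isIsogenous`, GZK, `hasEntireLFunction_rat`} — NO Imai, NO 27962, escape clause unused;
  `…_of_aliases` — over the route's live aliases `PublishedInputModularityU0RedT`, `PublishedInputsCasselsGZKEntireU0RedT`;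
* `missingPPartAt_of_lower_of_fineInputs_of_subTprime` — THE ROW TEXT OF `TameRankZeroAssembly` (item 19983) WITH
  `ReducibleKatoMember` REPLACED by the five named facts (branch A verbatim as in `tameRankZeroAssembly_proof`; branch B = the
  per-row U₀-red theorem, which needs only `¬ Irr`).

HONEST FRAMING.  Theorems only; conditional on the displayed named facts; closes nothing (19203 is closed by its glue over 27962;
M = 19196 ranges over potentially ORDINARY rows too and keeps Imai there); BSD is proved for no curve; nothing is booked.

References: [Kato2004Asterisque] Thm. 12.5 (p. 222), Thm. 14.5 (pp. 235–236), §14.14 (p. 243), Prop. 14.16 (2) (pp. 244–245);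
[Serre1967GroupesPDivisibles] §5 Prop. 8; [Imai1975] Theorem (p. 12); [Delbourgo1998] §1.5 (G); [Cassels1965ArithmeticVIII];
[Miller2011LMS] §1 Def. 1.1.
-/

-- the summit and its single problem are both named `BirchSwinnertonDyer` (registry layout D-0017)
set_option linter.dupNamespace false
set_option autoImplicit false

noncomputable section

open scoped Classical NumberField
open IsDedekindDomain WeierstrassCurve
open Literature.NumberTheory.EllipticCurves Literature.NumberTheory.EllipticCurves.ModularForms
  Literature.NumberTheory.EllipticCurves.Kato2004 Literature.NumberTheory.GaloisRepresentations
  Literature.NumberTheory.EllipticCurves.Rank1Residual Literature.NumberTheory.EllipticCurves.Rank1Residual.Typed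
open Summit.BirchSwinnertonDyer.Rank1Residual Summit.BirchSwinnertonDyer.Rank1Residual.Additive
open Summit.BirchSwinnertonDyer.BirchSwinnertonDyer.Theorems
open Summit.BirchSwinnertonDyer.BirchSwinnertonDyer.Theses.KatoDescentTamePotSupersingular

namespace Summit.BirchSwinnertonDyer.BirchSwinnertonDyer.Theorems.FineInputsPotSSKT

/-- **Item 19203 `TameUpperReducibleDefect` (K8-t′'s U₀-red) BY NAME from {modularity, Fine, H2X⁺, Lim 3.5, FW, Cassels, GZK,
entire `L`} — NO Imai, NO 27962, no small-torsion / parity clause used** (per row: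
`FineInputsPotSupersingular.missingUpperBoundAt_of_fineInputs_of_subTprime`). Conditional on the displayed named facts.
[cite: Kato2004Asterisque, proof of Prop. 14.16 (pp. 244–245), §14.14 (p. 243)] [cite: Serre1967GroupesPDivisibles, §5 Prop. 8]
[cite: Cassels1965ArithmeticVIII] -/
theorem tameUpperReducibleDefect_of_fineInputs (hmod : exists_isNewformOf)
    (hF : exists_memberHullZetaFineInputs) (hH : exists_iwasawaH2Data_fineSelmerDual_embedding_count)
    (hLim : Lim2017.thm35_fineSelmerDual_moduleFinite_of_classicalMuVanishes_of_le_divisionField)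
    (hFW : Literature.NumberTheory.IwasawaTheory.ferreroWashington1979_classicalMuVanishes)
    (hCassels : bsdRHS_eq_of_isIsogenous) (hGZK : rank_eq_analyticRank_of_analyticRank_le_one)
    (hmodL : hasEntireLFunction_rat) :
    Summit.BirchSwinnertonDyer.BirchSwinnertonDyer.Theses.KatoDescentTamePotSupersingular.TameUpperReducibleDefect := by
  intro W _ _ p _ hr hp2 hadd hT hred _
  exact FineInputsPotSupersingular.missingUpperBoundAt_of_fineInputs_of_subTprime hmod hF hH hLim hFW hCassels hGZK hmodL
    W p hp2 hadd hT hred hr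

/-- **The same over the route's live U₀-red aliases** `PublishedInputModularityU0RedT` and `PublishedInputsCasselsGZKEntireU0RedT`,
plus the four named facts Fine, H2X⁺, Lim 3.5, FW. Conditional; closes nothing.
[cite: Kato2004Asterisque, proof of Prop. 14.16 (pp. 244–245)] [cite: Serre1967GroupesPDivisibles, §5 Prop. 8] -/
theorem tameUpperReducibleDefect_of_fineInputs_of_aliases (hmod : PublishedInputModularityU0RedT)
    (hCGE : PublishedInputsCasselsGZKEntireU0RedT)
    (hF : exists_memberHullZetaFineInputs) (hH : exists_iwasawaH2Data_fineSelmerDual_embedding_count)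
    (hLim : Lim2017.thm35_fineSelmerDual_moduleFinite_of_classicalMuVanishes_of_le_divisionField)
    (hFW : Literature.NumberTheory.IwasawaTheory.ferreroWashington1979_classicalMuVanishes) :
    Summit.BirchSwinnertonDyer.BirchSwinnertonDyer.Theses.KatoDescentTamePotSupersingular.TameUpperReducibleDefect :=
  tameUpperReducibleDefect_of_fineInputs hmod hF hH hLim hFW hCGE.1 hCGE.2.1 hCGE.2.2

/-- **THE ROW TEXT OF `TameRankZeroAssembly` (item 19983) WITH CRUX M REPLACED by {modularity, Fine, H2X⁺, Lim 3.5, FW}**: on the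
covered tame rank-`0` rows, L₀ + Kato's upper half (branch A, verbatim as in `tameRankZeroAssembly_proof`:
`X4RankZero.missingPPartAt_iff_lower_of_kato`) resp. L₀ + the per-row U₀-red theorem (branch B; only `¬ Irr` of the branch is
used) give `MissingPPartAt W p` — NO Imai, NO 27962. Conditional on the displayed inputs; closes nothing.
[cite: Kato2004Asterisque, Thm. 14.5 (3) (p. 236), Prop. 14.16 (2) (pp. 244–245)] [cite: Serre1967GroupesPDivisibles, §5 Prop. 8]
[cite: Miller2011LMS, §1 and Def. 1.1] -/
theorem missingPPartAt_of_lower_of_fineInputs_of_subTprime (hL : TameLowerHalfRankZero) (hnf : exists_isNewformOf)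
    (hF : exists_memberHullZetaFineInputs) (hH : exists_iwasawaH2Data_fineSelmerDual_embedding_count)
    (hLim : Lim2017.thm35_fineSelmerDual_moduleFinite_of_classicalMuVanishes_of_le_divisionField)
    (hFW : Literature.NumberTheory.IwasawaTheory.ferreroWashington1979_classicalMuVanishes) (hP : PublishedInputsTame)
    (W : WeierstrassCurve ℚ) [W.IsElliptic] [W.IsGloballyMinimal] (p : ℕ) [Fact p.Prime] (hr : W.analyticRank = 0)
    (hp2 : p ≠ 2) (hadd : Addv W p) (hT : SubTprime W p)
    (hcov : ((∀ n : ℕ, W.HasSurjectiveModNGaloisRep (p ^ n : ℕ)) ∧ ¬ p ∣ W.tamagawaProduct ∧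
        ∃ (N : ℕ) (_ : NeZero N) (D : ModularParametrizationData W N), ¬ (p : ℤ) ∣ D.maninConstant) ∨
      (¬ W.HasIrreducibleModPGaloisRep p ∧
        (∀ (W' : WeierstrassCurve ℚ) [W'.IsElliptic], IsIsogenous W W' → ¬ p ^ 2 ∣ W'.torsionOrder) ∧
        ∀ q : ℚ, shaAn W = (q : ℂ) → Even (padicValRat p q))) :
    MissingPPartAt W p := by
  obtain ⟨hKato, hGZK, hmod, hCassels, hCT⟩ := hP
  have hlow : MissingLowerBoundAt W p := hL W p hr hp2 hadd hT
  have hO5 : ClassO5 W p := ⟨hp2, hadd, Or.inr hT⟩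
  have hpot : 0 ≤ padicValRat p W.j := hO5.padicValRat_j_nonneg
  rcases hcov with ⟨hsurj, htam, N, hN, D, hc⟩ | ⟨hred, -, -⟩
  · -- branch A: covered by Kato 14.5 (3) under (12.5.2) — the missing input IS the lower half
    haveI := hN
    haveI : NeZero (p : ℚ) := ⟨by exact_mod_cast (Fact.out : p.Prime).ne_zero⟩
    have hirr : W.HasIrreducibleModPGaloisRep p := by
      have h1 := hsurj 1
      simp only [pow_one] at h1
      exact hasIrreducibleModPGaloisRep_of_hasSurjectiveModNGaloisRep W p (by exact_mod_cast h1)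
    have hX : ClassX4 W p := ⟨hp2, hadd, hirr⟩
    exact (X4RankZero.missingPPartAt_iff_lower_of_kato W p hKato hGZK hmod hr hX hpot hsurj htam D
      hc).mpr hlow
  · -- branch B: reducible rows — the per-row U₀-red theorem (sharp count; NO Imai, NO 27962)
    exact missingPPartAt_of_lower_of_upper W p hlow
      (FineInputsPotSupersingular.missingUpperBoundAt_of_fineInputs_of_subTprime hnf hF hH hLim hFW hCassels hGZK hmod
        W p hp2 hadd hT hred hr)

end Summit.BirchSwinnertonDyer.BirchSwinnertonDyer.Theorems.FineInputsPotSSKT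

end
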